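import Mathlib
import HarnessLib.Audit
import Summits.PneNP.PneNP.Theorems.PstarHangingForest

/-!
# CLEAN CUTS: chords joining two skeleton components always pass the criterion; small terminal cores have no clean cut (ROUND-24, O1)

FRONTIER range-avoidance ladder, rung F-N3, ROUND 24 (cell `pnp-ideate`, prover-2 memo `g24/O1-NOFREEVERTEX-g24.md` §33; typed targets
`PstarCoreBoundTargets.TerminalFive` / `TerminalPeelable` (p646951); restricted-model proof complexity — nothing here bears on `P` versus `NP`).

A vertex set `W` is a CLEAN CUT of the family `K` (menu `M`) when every member of `K` CROSSING it (exactly one XOR endpoint in `W`) is an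
outside-gated chord of `K`.  Equivalently `W` is a union of connected components of the SKELETON `Sk(K, M)` = members of `K` that are not
outside-gated chords; a chord crosses some clean cut iff its endpoints lie in DIFFERENT skeleton components.

* `exists_two_crossings` — an XOR-closed family of at most five members whose XOR vertices lie on both sides of `W` has two distinct members
  crossing `W` (a side with at most one crossing member holds a leafless part, i.e. three members: `three_le_card_inside`).
* **`false_of_small_cleanCut`** — a terminal core of AT MOST FIVE members has no clean cut met on both sides.  Unconditional (strong induction:
  the two crossing chords are slice-generic — branch (B) and the location of sub-cores by PARITY on each side (`PstarHangingForest.false_of_even_on`,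
  `straddles_of_subcore`), sub-cores inherit the clean cut (`cleanCut_sub`) — then `PstarChordReadTwoClean.false_of_two_clean`).
* **`smallCriterion_of_crossing`** — in ANY family `J₀` (no terminality), a chord crossing a clean cut satisfies
  `NoSmallPathSumSubcore ∧ NoShortCoincidence` for the internal menu: a path-sum sub-core of it would straddle the cut (parity twice) and, having
  at most five members, would be a small terminal core with a clean cut.  So in the census every clean chord joining two skeleton components is
  EXEMPT from both tests, at every `k`.
* `xForest_iff_peelable` — `PstarHangingForest.XForest` is `PstarChordBridgeCotree.Peelable` (same definition; recorded for the reader).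
* The consequences inside the core-bound induction (`false_of_cleanCut_two`: no clean cut crossed twice; node `CleanCutCriterionBound` testing only
  skeleton-connected chords; `terminalFive_of_cutBound`) are in `PstarCleanCutAssembly`.
-/

set_option linter.dupNamespace false -- `Summit.PneNP.PneNP.…`: summit = sub-problem name (D-0017 single-conjunct layout)

open Finset Literature.Computability.Complexity
open Summit.PneNP.PneNP.Theorems.PstarTyped (Typed)
open Summit.PneNP.PneNP.Theorems.PstarSALevel (varSet bdry BoundaryExpanding SimpleOverlap)
open Summit.PneNP.PneNP.Theorems.PstarXCore (xpair mem_xpair xverts)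
open Summit.PneNP.PneNP.Theorems.PstarCoreBound (XorClosed)
open Summit.PneNP.PneNP.Theorems.PstarChordRepair (IsChord)
open Summit.PneNP.PneNP.Theorems.PstarCoreBoundTargets (Terminal TerminalFive TerminalFiveA TerminalPeelable nonchords nonchords_subset mem_nonchords
  terminalPeelable_of_terminalFive)
open Summit.PneNP.PneNP.Theorems.PstarSharingBound (sharedSlots)
open Summit.PneNP.PneNP.Theorems.PstarChordBridgeTools (xpdeg)
open Summit.PneNP.PneNP.Theorems.PstarChordBridgeFundamental (exists_mem_of_odd false_of_both_ends)
open Summit.PneNP.PneNP.Theorems.PstarChordBridgeExchange (mem_xverts_iff)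
open Summit.PneNP.PneNP.Theorems.PstarChordBridgeCotree (Peelable exists_leaf_edge mem_xverts_iff_xpdeg_pos card_xverts_le_of_leafless)
open Summit.PneNP.PneNP.Theorems.PstarChordBridgeCentre (exists_maximal_peelable_sup)
open Summit.PneNP.PneNP.Theorems.PstarNorUnitCoverTools (two_le_xpdeg_of_xorClosed exists_ne_of_two_le_xpdeg)
open Summit.PneNP.PneNP.Theorems.PstarChordReadOutside (OutsideGated)
open Summit.PneNP.PneNP.Theorems.PstarChordReadLemma (SliceGeneric)
open Summit.PneNP.PneNP.Theorems.PstarChordReadTwoClean (false_of_two_clean)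
open Summit.PneNP.PneNP.Theorems.PstarCleanChordCount (exists_clean_chords)
open Summit.PneNP.PneNP.Theorems.PstarTerminalPeelableTwelve (exists_centre_of_not_peelable)
open Summit.PneNP.PneNP.Theorems.PstarSliceGenericCriterion (NoPathSumSubcore NoShortCoincidence sliceGeneric_of_criterion sliceGeneric_of_criterionLin)
open Summit.PneNP.PneNP.Theorems.PstarSliceGenericInternal (internalMenu internalMenu_subset sliceGeneric_of_internal)
open Summit.PneNP.PneNP.Theorems.PstarTerminalFiveAssembly (NoSmallPathSumSubcore noPathSumSubcoreLin_of_small)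
open Summit.PneNP.PneNP.Theorems.PstarSkeletalSubcores (NoSkeletalPathSumSubcore false_of_clean_fold outsideGated_sub_of_clean
  noSmallPathSumSubcore_of_skeletal)
open Summit.PneNP.PneNP.Theorems.PstarNoFreeVertex (Covered covered_of_terminal outsideGated_anti vars_mem_xpair mem_xpair_of_mem_varSet)
open Summit.PneNP.PneNP.Theorems.PstarHangingForest (XForest Hanging Anchored anchored_of_terminal false_of_even_on two_leaves)

namespace Summit.PneNP.PneNP.Theorems.PstarCleanCut

variable {n m : ℕ}

/-- The member `f` CROSSES the vertex set `W`: exactly one of its XOR endpoints lies in `W`. -/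
def Crosses (I : LocalMap 4 n m) (W : Finset (Fin n)) (f : Fin m) : Prop :=
  (I.vars f 0 ∈ W ∧ I.vars f 1 ∉ W) ∨ (I.vars f 0 ∉ W ∧ I.vars f 1 ∈ W)

/-- **CLEAN CUT**: every member of `K` crossing `W` is an outside-gated chord of `K` for the menu `M`. -/
def CleanCut (I : LocalMap 4 n m) (K M : Finset (Fin m)) (W : Finset (Fin n)) : Prop :=
  ∀ f ∈ K, Crosses I W f → IsChord I K f ∧ OutsideGated I K M f

variable {I : LocalMap 4 n m} {r : ℕ} {y : Fin m → Bool}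

/-- `XForest` (of `PstarHangingForest`) is `Peelable` (of `PstarChordBridgeCotree`): the same definition. -/
theorem xForest_iff_peelable {T : Finset (Fin m)} : XForest I T ↔ Peelable I T := Iff.rfl

/-! ## Small logic of crossing -/

/-- Crossing the complement is crossing. -/
theorem crosses_compl {W : Finset (Fin n)} {f : Fin m} : Crosses I Wᶜ f ↔ Crosses I W f := by
  unfold Crosses
  rw [mem_compl, mem_compl, not_not, not_not, or_comm]

/-- A member meeting `W` without both endpoints in `W` crosses it. -/
theorem crosses_of_touch {W : Finset (Fin n)} {f : Fin m} (ht : I.vars f 0 ∈ W ∨ I.vars f 1 ∈ W)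
    (hnot : ¬ (I.vars f 0 ∈ W ∧ I.vars f 1 ∈ W)) : Crosses I W f := by
  unfold Crosses
  by_cases h0 : I.vars f 0 ∈ W
  · exact Or.inl ⟨h0, fun h1 => hnot ⟨h0, h1⟩⟩
  · exact Or.inr ⟨h0, ht.resolve_left h0⟩

/-- A member meeting `Wᶜ` without both endpoints in `Wᶜ` crosses `W`. -/
theorem crosses_of_touch_compl {W : Finset (Fin n)} {f : Fin m} (ht : I.vars f 0 ∈ Wᶜ ∨ I.vars f 1 ∈ Wᶜ)
    (hnot : ¬ (I.vars f 0 ∈ Wᶜ ∧ I.vars f 1 ∈ Wᶜ)) : Crosses I W f :=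
  crosses_compl.1 (crosses_of_touch ht hnot)

/-- A clean cut of `J₀` is a clean cut of every sub-family whose menu lies in the internal menu and the removed members. -/
theorem cleanCut_sub {J₀ 𝒢 K₀ M₀ : Finset (Fin m)} {W : Finset (Fin n)} (hcut : CleanCut I J₀ 𝒢 W) (hK₀ : K₀ ⊆ J₀)
    (hM₀ : M₀ ⊆ internalMenu I J₀ 𝒢 ∪ (J₀ \ K₀)) : CleanCut I K₀ M₀ W := fun f hf hc =>
  outsideGated_sub_of_clean hK₀ hM₀ hf (hcut f (hK₀ hf) hc).1 (hcut f (hK₀ hf) hc).2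

/-! ## Leafless parts and the two crossings of a small straddling family -/

/-- **A leafless non-empty family has at least three members** (simple overlaps: two members span at least three XOR vertices). -/
theorem three_le_card_of_leafless (hI : I.IsPure xorAndPred) (hS : SimpleOverlap I) {S : Finset (Fin m)} (hne : S.Nonempty)
    (hL : ∀ w, xpdeg I S w ≠ 1) : 3 ≤ S.card := by
  classical
  have hL2 : ∀ w ∈ xverts I S, 2 ≤ xpdeg I S w := fun w hw => by
    have h1 := (mem_xverts_iff_xpdeg_pos I S w).1 hw
    have h2 := hL w
    omega
  have hle := card_xverts_le_of_leafless I hL2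
  obtain ⟨o, ho⟩ := hne
  have h01 : I.vars o 0 ≠ I.vars o 1 := fun h => absurd (hI.2 o h) (by decide)
  have hxo : xpair I o ⊆ xverts I S := fun v hv => (mem_xverts_iff I S v).2 ⟨o, ho, hv⟩
  have h2 : 2 ≤ S.card := by
    have := card_le_card hxo
    rw [PstarXCore.xpair, card_pair h01] at this
    omega
  obtain ⟨o', ho', hne'⟩ := exists_mem_ne (show 1 < S.card by omega) o
  obtain ⟨s, hs, hout⟩ : ∃ s : Fin 4, s.val < 2 ∧ I.vars o' s ∉ xpair I o := by
    by_contra h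
    push Not at h
    exact false_of_both_ends I hI hS hne'.symm (h 0 (by decide)) (h 1 (by decide))
  have hsub : insert (I.vars o' s) (xpair I o) ⊆ xverts I S := by
    intro v hv
    rcases mem_insert.1 hv with rfl | hv
    · exact (mem_xverts_iff I S _).2 ⟨o', ho', vars_mem_xpair o' hs⟩
    · exact hxo hv
  have h3 : (insert (I.vars o' s) (xpair I o)).card = 3 := by
    rw [card_insert_of_notMem hout, PstarXCore.xpair, card_pair h01]
  have := card_le_card hsub
  omega

/-- **A side of a cut met by an XOR-closed family and crossed by at most one member holds three members**: if some XOR vertex of `K` lies in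
`W` and every member of `K` crossing `W` equals `e₀`, then at least three members of `K` have both XOR endpoints in `W`. -/
theorem three_le_card_inside (hI : I.IsPure xorAndPred) (hT : Typed I) (hS : SimpleOverlap I) {K : Finset (Fin m)} (hX : XorClosed I K)
    {W : Finset (Fin n)} {e₀ : Fin m} (hv : ∃ v ∈ xverts I K, v ∈ W) (hcross : ∀ f ∈ K, Crosses I W f → f = e₀) :
    3 ≤ (K.filter fun f => I.vars f 0 ∈ W ∧ I.vars f 1 ∈ W).card := by
  classical
  set A := K.filter fun f => I.vars f 0 ∈ W ∧ I.vars f 1 ∈ W with hA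
  -- a member through a vertex of `W`, other than `e₀`, lies inside `W`
  have memA : ∀ f ∈ K, ∀ v ∈ W, v ∈ xpair I f → f ≠ e₀ → f ∈ A := by
    intro f hf v hvW hvf hne
    rw [hA, mem_filter]
    refine ⟨hf, ?_⟩
    by_contra hnot
    refine hne (hcross f hf (crosses_of_touch ?_ hnot))
    rcases (mem_xpair I).1 hvf with e | e
    · exact Or.inl (e ▸ hvW)
    · exact Or.inr (e ▸ hvW)
  have hAK : A ⊆ K := filter_subset _ K
  have hAW : ∀ f ∈ A, I.vars f 0 ∈ W ∧ I.vars f 1 ∈ W := fun f hf => (mem_filter.1 hf).2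
  have hAne : A.Nonempty := by
    obtain ⟨v, hv, hvW⟩ := hv
    obtain ⟨f₀, hf₀, hvf₀⟩ := (mem_xverts_iff I K v).1 hv
    obtain ⟨f₁, hf₁, hne, hvf₁⟩ := exists_ne_of_two_le_xpdeg I hI f₀ (two_le_xpdeg_of_xorClosed I hT hX v hv)
    by_cases h0 : f₀ = e₀
    · exact ⟨f₁, memA f₁ hf₁ v hvW hvf₁ fun h => hne (h.trans h0.symm)⟩
    · exact ⟨f₀, memA f₀ hf₀ v hvW hvf₀ h0⟩
  -- `A` is not an X-forest: each leaf of `A` would carry `e₀`, with the leaf in `W`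
  obtain ⟨S, hSA, hSne, hSL⟩ : ∃ S ⊆ A, S.Nonempty ∧ ∀ w, xpdeg I S w ≠ 1 := by
    by_contra hno
    push Not at hno
    obtain ⟨w, w', hww', hw, hw'⟩ := two_leaves hI A hAne fun S hS' hSne => hno S hS' hSne
    have leaf : ∀ u, xpdeg I A u = 1 → u ∈ W ∧ u ∈ xpair I e₀ ∧ Crosses I W e₀ := by
      intro u hu
      obtain ⟨o, ho, huo, huniq⟩ := exists_leaf_edge I hu
      have huW : u ∈ W := by
        rcases (mem_xpair I).1 huo with e | e
        · rw [e]; exact (hAW o ho).1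
        · rw [e]; exact (hAW o ho).2
      have hux : u ∈ xverts I K := (mem_xverts_iff I K u).2 ⟨o, hAK ho, huo⟩
      obtain ⟨f, hf, hfo, huf⟩ := exists_ne_of_two_le_xpdeg I hI o (two_le_xpdeg_of_xorClosed I hT hX u hux)
      have hfA : f ∉ A := fun hfA => hfo (huniq f hfA huf)
      have hfe : f = e₀ := by
        by_contra hne
        exact hfA (memA f hf u huW huf hne)
      subst hfe
      refine ⟨huW, huf, crosses_of_touch ?_ fun hb => hfA (by rw [hA, mem_filter]; exact ⟨hf, hb⟩)⟩
      rcases (mem_xpair I).1 huf with e | e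
      · exact Or.inl (e ▸ huW)
      · exact Or.inr (e ▸ huW)
    obtain ⟨hwW, hwe, hcr⟩ := leaf w hw
    obtain ⟨hw'W, hw'e, -⟩ := leaf w' hw'
    rcases (mem_xpair I).1 hwe with h0 | h1 <;> rcases (mem_xpair I).1 hw'e with h0' | h1'
    · exact hww' (h0.trans h0'.symm)
    · rcases hcr with ⟨-, hb⟩ | ⟨ha, -⟩
      · exact hb (h1' ▸ hw'W)
      · exact ha (h0 ▸ hwW)
    · rcases hcr with ⟨-, hb⟩ | ⟨ha, -⟩
      · exact hb (h1 ▸ hwW)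
      · exact ha (h0' ▸ hw'W)
    · exact hww' (h1.trans h1'.symm)
  exact (three_le_card_of_leafless hI hS hSne hSL).trans (card_le_card hSA)

/-- **A SMALL XOR-CLOSED FAMILY STRADDLING A CUT CROSSES IT TWICE**: at most five members, XOR vertices on both sides of `W` ⟹ two distinct
members cross `W`. -/
theorem exists_two_crossings (hI : I.IsPure xorAndPred) (hT : Typed I) (hS : SimpleOverlap I) {K : Finset (Fin m)} (hX : XorClosed I K)
    (h5 : K.card ≤ 5) {W : Finset (Fin n)} (hin : ∃ v ∈ xverts I K, v ∈ W) (hout : ∃ v ∈ xverts I K, v ∉ W) :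
    ∃ e₁ ∈ K, ∃ e₂ ∈ K, e₁ ≠ e₂ ∧ Crosses I W e₁ ∧ Crosses I W e₂ := by
  classical
  by_contra hno
  push Not at hno
  obtain ⟨e₀, he₀⟩ : ∃ e₀ : Fin m, ∀ f ∈ K, Crosses I W f → f = e₀ := by
    by_cases hex : ∃ f ∈ K, Crosses I W f
    · obtain ⟨f, hf, hcf⟩ := hex
      refine ⟨f, fun g hg hcg => ?_⟩
      by_contra hne
      exact hno g hg f hf hne hcg hcf
    · push Not at hex
      obtain ⟨v, hv, -⟩ := hin
      obtain ⟨f₀, -, -⟩ := (mem_xverts_iff I K v).1 hv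
      exact ⟨f₀, fun g hg hcg => absurd hcg (hex g hg)⟩
  have hA := three_le_card_inside hI hT hS hX hin he₀
  have hout' : ∃ v ∈ xverts I K, v ∈ Wᶜ := by
    obtain ⟨v, hv, hvW⟩ := hout
    exact ⟨v, hv, mem_compl.2 hvW⟩
  have hB := three_le_card_inside hI hT hS hX hout' fun f hf hc => he₀ f hf (crosses_compl.1 hc)
  have hdisj : Disjoint (K.filter fun f => I.vars f 0 ∈ W ∧ I.vars f 1 ∈ W) (K.filter fun f => I.vars f 0 ∈ Wᶜ ∧ I.vars f 1 ∈ Wᶜ) :=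
    disjoint_filter.2 fun f _ h h' => (mem_compl.1 h'.1) h.1
  have hle := card_le_card (union_subset (filter_subset (fun f => I.vars f 0 ∈ W ∧ I.vars f 1 ∈ W) K)
    (filter_subset (fun f => I.vars f 0 ∈ Wᶜ ∧ I.vars f 1 ∈ Wᶜ) K))
  rw [card_union_of_disjoint hdisj] at hle
  omega

/-! ## Chords crossing a clean cut: branch (B), and the location of path-sum sub-cores -/
section Crossing

variable {J₀ 𝒢 : Finset (Fin m)} {W : Finset (Fin n)} {c : Fin m}

/-- **BRANCH (B) FOR A CHORD CROSSING A CLEAN CUT** (any sub-menu `M' ⊆ 𝒢`): a coincidence through `c` meets `W` only in members inside `W`,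
against parity. -/
theorem noShortCoincidence_of_crossing (hcut : CleanCut I J₀ 𝒢 W) (hcross : Crosses I W c) {M' : Finset (Fin m)} (hM' : M' ⊆ 𝒢) :
    NoShortCoincidence I J₀ c M' := by
  intro F hF _ hnoclean heven _ _
  have hcF : c ∉ F := fun h => (mem_erase.1 (hF h)).1 rfl
  refine false_of_even_on I hcF hcross (fun f hf ht => ?_) fun w _ => heven w
  by_contra hnot
  obtain ⟨hch, hO⟩ := hcut f (mem_of_mem_erase (hF hf)) (crosses_of_touch ht hnot)
  exact hnoclean f hf hch (outsideGated_anti hM' hO)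

/-- **A PATH-SUM SUB-CORE OF A CROSSING CHORD STRADDLES THE CUT.**  Given the branch-(A) data of a chord `c` crossing a clean cut `W` of `J₀`
(menu `𝒢` disjoint from `J₀`, monomials in the internal menu and `J₀ ∖ K₀`), a terminal sub-core `K₀` has XOR vertices on both sides of `W`:
folds crossing `W` are clean folds, the other folds meeting a side lie inside it, and parity on each side puts an odd vertex of `c + F₁` —
a vertex read by `K₀` — on it. -/
theorem straddles_of_subcore (hI : I.IsPure xorAndPred) (hT : Typed I) (hS : SimpleOverlap I) (hB : BoundaryExpanding r I)
    {K₀ F₁ : Finset (Fin m)} {d₁ d₂ : Finset (Fin n) × Finset (Fin m) × Bool} (ht : Terminal I r y K₀ d₁ d₂) (hK₀ : K₀ ⊆ J₀.erase c)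
    (hdisj : Disjoint J₀ 𝒢) (hF₁ : F₁ ⊆ J₀.erase c \ K₀) (hm₁ : d₁.2.1 = F₁) (hmono : d₁.2.1 ∪ d₂.2.1 ⊆ internalMenu I J₀ 𝒢 ∪ (J₀ \ K₀))
    (hlin : ∀ v, v ∈ d₁.1 ↔ Odd (xpdeg I (insert c F₁) v)) (hread : ∀ v ∈ d₁.1, ∃ f ∈ K₀, v ∈ varSet I f)
    (hcut : CleanCut I J₀ 𝒢 W) (hcross : Crosses I W c) :
    (∃ v ∈ xverts I K₀, v ∈ W) ∧ (∃ v ∈ xverts I K₀, v ∉ W) := by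
  classical
  have hcF : c ∉ F₁ := fun h => (mem_erase.1 (mem_sdiff.1 (hF₁ h)).1).1 rfl
  have hK₀J : K₀ ⊆ J₀ := hK₀.trans (erase_subset c J₀)
  -- a fold crossing `W` is a clean fold
  have nocross : ∀ f ∈ F₁, ¬ Crosses I W f := by
    intro f hf hc
    have hfJ : f ∈ J₀ := mem_of_mem_erase (mem_sdiff.1 (hF₁ hf)).1
    obtain ⟨hch, hO⟩ := hcut f hfJ hc
    have hfm : f ∈ d₁.2.1 ∪ d₂.2.1 := mem_union_left _ (by rw [hm₁]; exact hf)
    exact false_of_clean_fold hI hT hS hB ht hK₀J hdisj hmono hfm hfJ hch hO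
  -- odd vertices of `c + F₁` are XOR vertices of `K₀`
  have oddx : ∀ w, Odd (xpdeg I (insert c F₁) w) → w ∈ xverts I K₀ := by
    intro w hodd
    obtain ⟨g, hg, hwg⟩ := hread w ((hlin w).2 hodd)
    obtain ⟨j, -, hwj⟩ := exists_mem_of_odd I hodd
    obtain ⟨s, hs, hsw⟩ : ∃ s : Fin 4, s.val < 2 ∧ I.vars j s = w := by
      rcases (mem_xpair I).1 hwj with e | e
      · exact ⟨0, by decide, e.symm⟩
      · exact ⟨1, by decide, e.symm⟩
    subst hsw
    exact (mem_xverts_iff I K₀ _).2 ⟨g, hg, mem_xpair_of_mem_varSet hT hs hwg⟩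
  constructor
  · by_contra hno
    push Not at hno
    refine false_of_even_on I hcF hcross (fun f hf ht' => ?_) fun w hw => ?_
    · by_contra hnot
      exact nocross f hf (crosses_of_touch ht' hnot)
    · by_contra hodd
      exact hno w (oddx w (Nat.not_even_iff_odd.1 hodd)) hw
  · by_contra hno
    push Not at hno
    refine false_of_even_on I (W := Wᶜ) hcF (crosses_compl.2 hcross) (fun f hf ht' => ?_) fun w hw => ?_
    · by_contra hnot
      exact nocross f hf (crosses_of_touch_compl ht' hnot)
    · by_contra hodd
      exact (mem_compl.1 hw) (hno w (oddx w (Nat.not_even_iff_odd.1 hodd)))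

end Crossing

/-! ## Small terminal cores have no clean cut -/

/-- **SMALL TERMINAL CORES HAVE NO CLEAN CUT.**  A terminal core `(K; d₁, d₂)` of at most five members admits no vertex set `W` with XOR vertices of
`K` on both sides such that every member crossing `W` is an outside-gated chord (menu `d₁.G ∪ d₂.G`).  Unconditional. -/
theorem false_of_small_cleanCut (hI : I.IsPure xorAndPred) (hT : Typed I) (hS : SimpleOverlap I) (hB : BoundaryExpanding r I)
    {K : Finset (Fin m)} {d₁ d₂ : Finset (Fin n) × Finset (Fin m) × Bool} (ht : Terminal I r y K d₁ d₂) (h5 : K.card ≤ 5)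
    {W : Finset (Fin n)} (hin : ∃ v ∈ xverts I K, v ∈ W) (hout : ∃ v ∈ xverts I K, v ∉ W) (hcut : CleanCut I K (d₁.2.1 ∪ d₂.2.1) W) :
    False := by
  classical
  suffices H : ∀ (k : ℕ) (K : Finset (Fin m)) (d₁ d₂ : Finset (Fin n) × Finset (Fin m) × Bool), K.card = k → K.card ≤ 5 →
      Terminal I r y K d₁ d₂ → (∃ v ∈ xverts I K, v ∈ W) → (∃ v ∈ xverts I K, v ∉ W) → CleanCut I K (d₁.2.1 ∪ d₂.2.1) W → False from
    H _ K d₁ d₂ rfl h5 ht hin hout hcut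
  intro k
  induction k using Nat.strong_induction_on with
  | _ k ih =>
    intro K d₁ d₂ hk h5 ht hin hout hcut
    have hX : XorClosed I K := ht.2.1
    have hKr : K.card < r := ht.2.2.1
    have hdisj : Disjoint K (d₁.2.1 ∪ d₂.2.1) := disjoint_union_right.2 ⟨ht.2.2.2.1, ht.2.2.2.2.1⟩
    have hr : (K ∪ (d₁.2.1 ∪ d₂.2.1)).card ≤ r := by rw [← union_assoc]; exact ht.2.2.2.2.2.1
    have hM' : internalMenu I K (d₁.2.1 ∪ d₂.2.1) ⊆ d₁.2.1 ∪ d₂.2.1 := internalMenu_subset I K _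
    obtain ⟨e₁, he₁, e₂, he₂, hne, hc₁, hc₂⟩ := exists_two_crossings hI hT hS hX h5 hin hout
    -- every crossing chord is slice-generic
    have hgen : ∀ e ∈ K, Crosses I W e → SliceGeneric I y K e (d₁.2.1 ∪ d₂.2.1) := by
      intro e he hce
      obtain ⟨hch, hO⟩ := hcut e he hce
      have hBe : NoShortCoincidence I K e (internalMenu I K (d₁.2.1 ∪ d₂.2.1)) := noShortCoincidence_of_crossing hcut hce hM'
      have hAe : NoPathSumSubcore I r y K e (internalMenu I K (d₁.2.1 ∪ d₂.2.1)) := by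
        intro K₁ hK₁ _ _ F F' t d₁' d₂' hF hF' hm₁ hm₂ hlin hread _ ht₁
        have hK₁K : K₁ ⊆ K := hK₁.trans (erase_subset e K)
        have hsd : (K.erase e) \ K₁ ⊆ K \ K₁ := sdiff_subset_sdiff (erase_subset e K) (Subset.refl _)
        have hmono : d₁'.2.1 ∪ d₂'.2.1 ⊆ internalMenu I K (d₁.2.1 ∪ d₂.2.1) ∪ (K \ K₁) := by
          refine union_subset ?_ (hm₂.trans (union_subset_union (Subset.refl _) (hF'.trans hsd)))
          rw [hm₁]
          exact (hF.trans hsd).trans subset_union_right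
        obtain ⟨hin₁, hout₁⟩ := straddles_of_subcore hI hT hS hB ht₁ hK₁ hdisj hF hm₁ hmono hlin hread hcut hce
        have hlt : K₁.card < k := by
          rw [← hk]
          exact lt_of_le_of_lt (card_le_card hK₁) (card_erase_lt_of_mem he)
        exact ih K₁.card hlt K₁ d₁' d₂' rfl ((card_le_card hK₁K).trans h5) ht₁ hin₁ hout₁ (cleanCut_sub hcut hK₁K hmono)
      have hdisj' : Disjoint K (internalMenu I K (d₁.2.1 ∪ d₂.2.1)) := hdisj.mono_right hM'
      have hr' : (K ∪ internalMenu I K (d₁.2.1 ∪ d₂.2.1)).card ≤ r :=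
        (card_le_card (union_subset_union (Subset.refl _) hM')).trans hr
      exact sliceGeneric_of_internal hI hT hS hB hKr.le he hch hO (sliceGeneric_of_criterion hI hT hS hB he hdisj' hr' hAe hBe)
    obtain ⟨hch₁, hO₁⟩ := hcut e₁ he₁ hc₁
    obtain ⟨hch₂, hO₂⟩ := hcut e₂ he₂ hc₂
    exact false_of_two_clean hI hT hS hB ht he₁ he₂ hne hch₁ hch₂ hO₁ hO₂ (hgen e₁ he₁ hc₁) (hgen e₂ he₂ hc₂)

/-! ## Chords crossing a clean cut pass the criterion, in any family -/
section AnyFamily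

variable {J₀ 𝒢 : Finset (Fin m)} {W : Finset (Fin n)} {c : Fin m}

/-- **A CHORD CROSSING A CLEAN CUT PASSES THE SMALL CRITERION** (any family `J₀`, menu `𝒢` disjoint from `J₀`; no terminality):
`NoSmallPathSumSubcore` and `NoShortCoincidence` for the internal menu. -/
theorem smallCriterion_of_crossing (hI : I.IsPure xorAndPred) (hT : Typed I) (hS : SimpleOverlap I) (hB : BoundaryExpanding r I)
    (hdisj : Disjoint J₀ 𝒢) (hcut : CleanCut I J₀ 𝒢 W) (hcross : Crosses I W c) :
    NoSmallPathSumSubcore I r y J₀ c (internalMenu I J₀ 𝒢) ∧ NoShortCoincidence I J₀ c (internalMenu I J₀ 𝒢) := by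
  refine ⟨?_, noShortCoincidence_of_crossing hcut hcross (internalMenu_subset I J₀ 𝒢)⟩
  intro K₀ hK₀ _ _ h5 F₁ F₂ t d₁ d₂ hF₁ hF₂ hm₁ hm₂ _ hlin hread _ _ ht
  have hK₀J : K₀ ⊆ J₀ := hK₀.trans (erase_subset c J₀)
  have hsd : (J₀.erase c) \ K₀ ⊆ J₀ \ K₀ := sdiff_subset_sdiff (erase_subset c J₀) (Subset.refl _)
  have hmono : d₁.2.1 ∪ d₂.2.1 ⊆ internalMenu I J₀ 𝒢 ∪ (J₀ \ K₀) := by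
    refine union_subset ?_ (hm₂.trans (union_subset_union (Subset.refl _) (hF₂.trans hsd)))
    rw [hm₁]
    exact (hF₁.trans hsd).trans subset_union_right
  obtain ⟨hin, hout⟩ := straddles_of_subcore hI hT hS hB ht hK₀ hdisj hF₁ hm₁ hmono hlin hread hcut hcross
  exact false_of_small_cleanCut hI hT hS hB ht h5 hin hout (cleanCut_sub hcut hK₀J hmono)

/-- The skeletal node follows as well. -/
theorem noSkeletalPathSumSubcore_of_crossing (hI : I.IsPure xorAndPred) (hT : Typed I) (hS : SimpleOverlap I) (hB : BoundaryExpanding r I)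
    (hdisj : Disjoint J₀ 𝒢) (hcut : CleanCut I J₀ 𝒢 W) (hcross : Crosses I W c) : NoSkeletalPathSumSubcore I r y J₀ c 𝒢 :=
  fun K₀ hK₀ hne hX h5 F₁ F₂ t d₁ d₂ hF₁ hF₂ hm₁ hm₂ hne' _ hlin hread hread₂ hslice ht =>
    (smallCriterion_of_crossing hI hT hS hB hdisj hcut hcross).1 K₀ hK₀ hne hX h5 F₁ F₂ t d₁ d₂ hF₁ hF₂ hm₁ hm₂ hne' hlin hread hread₂
      hslice ht

end AnyFamily

end Summit.PneNP.PneNP.Theorems.PstarCleanCut
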